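import Summits.CriticalPhenomena.PercolationContinuityZ3.Theses.PercEventualDensity
import Literature.Probability.Percolation.KestenZhangTailProofs
import Literature.Probability.Percolation.HalfSpaceProofs
import Literature.Probability.Percolation.CriticalContinuityProofs
import Literature.Probability.Percolation.SharpnessDCTProofs

/-!
# Disproof file of the crux `DropletSurfaceCost` (stmt-CriticalPhenomena-17921) — birth attack

Author: refuter-rattack-stmt-CriticalPhenomena-17921-0 (crux-attack at birth, 2026-08-17).

Findings (details and the paper proofs: `COSTUME.md` attached to the item):

* `DropletSurfaceCost` (`K_d`) is NOT refutable: true for `p > p_c` (`Grimmett1999_thm_8_65_holds`), vacuous for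
  `p < p_c`, content only at a hypothetical percolating `p_c`. Hypothesis satisfiable (`hyp_satisfiable`, `p = 1`).
* COSTUME: `K_d → PercolationContinuityZ3` SOFTLY. The reduction is PROVED here (sorry-free, axioms
  propext/choice/Quot.sound) as
  `continuity_of_dropletSurfaceCost : StripDensityLB p_c → CheapBlocking p_c → K_d → PercolationContinuityZ3`,
  i.e. the whole assembly with explicit constants (`A = 384·log(1/p_c)/θ + 1`, `K = ⌈θ/(768δ₀)⌉` strips per face,
  density `δ = θ/(768K)`, scales `M = 2m`, `L = 4m`, `ε = δ/(4·log(1/(1−p_c)))`) is kernel-checked; what remains are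
  the two hypotheses, short paper lemmas stated below as precise `Prop`s over the tree's API (Lemma 1: Markov + strip
  pigeonhole + Harris + shift, valid at EVERY p; Lemma 2: touching-edge identity + Jensen +
  `BarskyGrimmettNewman1991_holds`, valid at `p_c`) for a prover to discharge (est. 1–2 kLoC together).
* Consequence: with `S → K_d` (Kesten–Zhang, the planner's birth skeleton) the crux is soft-equivalent to the
  conjunct — route kill-criterion (ii); `SomeScaleDensity` and the four supports are not needed by `closes`; the same
  two lemmas make the shared crux `FiniteClusterVolumeTail` (stmt-0943) imply the conjunct (COSTUME.md §5).
-/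

namespace Summit.CriticalPhenomena.PercolationContinuityZ3.Cruxes.DropletSurfaceCost.Disproof

open Literature.Probability.Percolation Literature.Probability.LatticeModels

/-- Non-vacuity of the crux hypothesis `0 < θ(p)`: witnessed at `p = 1` (tree: `theta_one`). -/
theorem hyp_satisfiable : 0 < theta (zdGraph 3) 0 1 := by
  rw [Literature.Probability.Percolation.DCT16.theta_one (by norm_num)]; norm_num

/-- The in-ball cluster `C^S(x) = {v | x ↔ v inside S}` (the route's `C^m(0)` is `inBox ω ↑(box 3 m) 0`). -/
def inBox (ω : BondConfig (Site 3)) (S : Set (Site 3)) (x : Site 3) : Set (Site 3) :=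
  {v | ω ∈ openConnIn S x v}

/-- **Lemma 1 (strip pigeonhole), at parameter `p`** — COSTUME.md §3: for `K ≥ 1` strips per face and `m ≥ 1`,
`P_p(#C^{B_{2m}}(0) ≥ (θ/(12K))(2m+1)³) ≥ (θ²/(144K²))·p^{2(2m+1)²/K + 2(2m+1)}`, `θ = θ(p)`.
Paper proof: Markov (`P(#{x∈B_m : x↔∞} ≥ (θ/2)#B_m) ≥ θ/2`), every such `x` reaches `∂B_m` inside `B_m`, cover `∂B_m`
by `≤ 6K` face strips, pigeonhole, Harris (`harris_fkg_holds`) with "strip fully open", average over the dense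
component and shift to the origin (`bondPercolation_map_shift`). Valid at EVERY `p` (no criticality used). -/
def StripDensityLB (p : unitInterval) : Prop :=
  ∀ K : ℕ, 1 ≤ K → ∀ m : ℕ, 1 ≤ m →
    theta (zdGraph 3) 0 p ^ 2 / (144 * (K : ℝ) ^ 2) *
        (p : ℝ) ^ (2 * (2 * (m : ℝ) + 1) ^ 2 / (K : ℝ) + 2 * (2 * (m : ℝ) + 1))
      ≤ (bondPercolation (zdGraph 3) p).real
          {ω | theta (zdGraph 3) 0 p / (12 * (K : ℝ)) * (2 * (m : ℝ) + 1) ^ 3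
                ≤ ((inBox ω ↑(box 3 (2 * m)) 0).ncard : ℝ)}

/-- **Lemma 2 (cheap blocking), at parameter `p`** — COSTUME.md §3: for every `ε > 0`, for all large `M` and all `k`,
`P_p(C(0) ⊆ B_{2M} ∧ k ≤ #C(0)) ≥ P_p(k ≤ #C^{B_M}(0))·(1−p)^{ε(2M+1)²}`.
Paper proof: independence of the In / Out / Bd edge classes, the touching-edge identity
`P(all dangerous boundary edges closed | Out) = (1−p)^{#Φ}`, Jensen, and `E#Φ = o(M²)` from the half-space one-arm
decay `P(0 ↔ ∂B_r in ℍ) ↓ θ_ℍ(p)`; at `p = p_c`, `θ_ℍ(p_c) = 0` is `BarskyGrimmettNewman1991_holds`. Valid exactly at the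
`p` with `θ_ℍ(p) = 0`, in particular at `p_c`; FALSE for `p > p_c`. -/
def CheapBlocking (p : unitInterval) : Prop :=
  ∀ ε : ℝ, 0 < ε → ∃ M₀ : ℕ, ∀ M : ℕ, M₀ ≤ M → ∀ k : ℕ,
    (bondPercolation (zdGraph 3) p).real {ω | (k : ℝ) ≤ ((inBox ω ↑(box 3 M) 0).ncard : ℝ)} *
        (1 - (p : ℝ)) ^ (ε * (2 * (M : ℝ) + 1) ^ 2)
      ≤ (bondPercolation (zdGraph 3) p).real
          {ω | openCluster ω 0 ⊆ ↑(box 3 (2 * M)) ∧ (k : ℝ) ≤ ((openCluster ω 0).ncard : ℝ)}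

/-- **The costume reduction** (COSTUME.md §3, Assembly; PROVED): Lemma 1 and Lemma 2 at `p_c` turn the crux into
the conjunct. Constants: `A := 384·log(1/p_c)/θ + 1`, `K := ⌈θ/(768 δ₀)⌉`, `δ := θ/(768K)`, boxes `M = 2m`, `L = 4m`,
`ε := δ/(4 log(1/(1−p_c)))`; the droplet inequality of `K_d` then reads `12δm² ≤ bb·m + cc`, absurd for large `m`.
Tree inputs: `Grimmett1999_criticalProb_pos_lt_one_holds` (`0 < p_c < 1`), `percolationContinuityZ3_iff`. -/
theorem continuity_of_dropletSurfaceCost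
    (h1 : StripDensityLB (criticalProbI 3)) (h2 : CheapBlocking (criticalProbI 3))
    (hK : Theses.PercEventualDensity.DropletSurfaceCost) : _root_.PercolationContinuityZ3 := by
  rw [show _root_.PercolationContinuityZ3 ↔ theta (zdGraph 3) 0 (criticalProbI 3) = 0 from
    percolationContinuityZ3_iff]
  by_contra hne
  set pc : unitInterval := criticalProbI 3 with hpc_def
  set θ : ℝ := theta (zdGraph 3) 0 pc with hθ_def
  have hθnn : 0 ≤ θ := MeasureTheory.measureReal_nonneg
  have hθpos : 0 < θ := lt_of_le_of_ne hθnn (Ne.symm hne)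
  have hθne : θ ≠ 0 := hθpos.ne'
  -- `0 < p_c < 1`
  have hpc01 := Grimmett1999_criticalProb_pos_lt_one_holds 3 (by norm_num)
  have hpcR : ((pc : unitInterval) : ℝ) = criticalProb (zdGraph 3) (0 : Site 3) := rfl
  have hpc0 : 0 < (pc : ℝ) := by rw [hpcR]; exact hpc01.1
  have hpc1 : (pc : ℝ) < 1 := by rw [hpcR]; exact hpc01.2
  have h1pc0 : 0 < 1 - (pc : ℝ) := by linarith
  set ℓ : ℝ := -Real.log (pc : ℝ) with hℓ_def
  set Lc : ℝ := -Real.log (1 - (pc : ℝ)) with hLc_def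
  have hℓpos : 0 < ℓ := by
    have := Real.log_neg hpc0 hpc1
    rw [hℓ_def]; linarith
  have hLcpos : 0 < Lc := by
    have := Real.log_neg h1pc0 (by linarith)
    rw [hLc_def]; linarith
  have hLcne : Lc ≠ 0 := hLcpos.ne'
  -- the rate `A`, the planner's `δ₀(A)`
  set A : ℝ := 384 * ℓ / θ + 1 with hA_def
  have hApos : 0 < A := by positivity
  obtain ⟨δ₀, hδ₀, hKd⟩ := hK pc hθpos A hApos
  -- `K` strips per face, density `δ = θ/(768K) ≤ δ₀`
  set K : ℕ := ⌈θ / (768 * δ₀)⌉₊ with hK_def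
  have hKpos_real : 0 < θ / (768 * δ₀) := by positivity
  have hK1 : 1 ≤ K := Nat.ceil_pos.mpr hKpos_real
  have hKr1 : (1 : ℝ) ≤ (K : ℝ) := by exact_mod_cast hK1
  have hKrpos : (0 : ℝ) < (K : ℝ) := by linarith
  have hKne : (K : ℝ) ≠ 0 := hKrpos.ne'
  set δ : ℝ := θ / (768 * (K : ℝ)) with hδ_def
  have hδpos : 0 < δ := by positivity
  have hδle : δ ≤ δ₀ := by
    have hle : θ / (768 * δ₀) ≤ (K : ℝ) := Nat.le_ceil _
    have hle' : θ ≤ (K : ℝ) * (768 * δ₀) := (div_le_iff₀ (by positivity)).mp hle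
    rw [hδ_def, div_le_iff₀ (by positivity)]
    calc θ ≤ (K : ℝ) * (768 * δ₀) := hle'
      _ = δ₀ * (768 * (K : ℝ)) := by ring
  obtain ⟨m₀', hm₀'⟩ := hKd δ hδpos hδle
  -- blocking parameter `ε = δ/(4 L_c)`
  set ε : ℝ := δ / (4 * Lc) with hε_def
  have hεpos : 0 < ε := by positivity
  obtain ⟨M₀, hM₀⟩ := h2 ε hεpos
  -- algebra of the constants
  set u : ℝ := ℓ / (K : ℝ) with hu_def
  have hunn : 0 ≤ u := by positivity
  have hAδ : A * δ = u / 2 + δ := by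
    rw [hA_def, hδ_def, hu_def]; field_simp; ring
  set c₀ : ℝ := Real.log (θ ^ 2 / (144 * (K : ℝ) ^ 2)) with hc₀_def
  set bb : ℝ := 8 * u + 4 * ℓ + 2 * δ with hbb_def
  set cc : ℝ := -c₀ + 2 * u + 2 * ℓ + δ / 4 with hcc_def
  -- a large scale `m`
  obtain ⟨m, hm⟩ := exists_nat_ge (max (max (m₀' : ℝ) (M₀ : ℝ)) (max 1 ((bb + |cc| + 1) / (12 * δ))))
  have hm₀'m : (m₀' : ℝ) ≤ m := le_trans (le_trans (le_max_left _ _) (le_max_left _ _)) hm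
  have hM₀m : (M₀ : ℝ) ≤ m := le_trans (le_trans (le_max_right _ _) (le_max_left _ _)) hm
  have h1m : (1 : ℝ) ≤ m := le_trans (le_trans (le_max_left _ _) (le_max_right _ _)) hm
  have hbig : (bb + |cc| + 1) / (12 * δ) ≤ m := le_trans (le_trans (le_max_right _ _) (le_max_right _ _)) hm
  have hm1 : 1 ≤ m := by exact_mod_cast h1m
  have hm₀'4m : m₀' ≤ 4 * m := by
    have : (m₀' : ℝ) ≤ 4 * (m : ℝ) := by linarith only [hm₀'m, h1m]
    exact_mod_cast this
  have hM₀2m : M₀ ≤ 2 * m := by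
    have : (M₀ : ℝ) ≤ 2 * (m : ℝ) := by linarith only [hM₀m, h1m]
    exact_mod_cast this
  -- the three percolation inputs at scale `m`
  have i1 : θ ^ 2 / (144 * (K : ℝ) ^ 2) *
        (pc : ℝ) ^ (2 * (2 * (m : ℝ) + 1) ^ 2 / (K : ℝ) + 2 * (2 * (m : ℝ) + 1))
      ≤ (bondPercolation (zdGraph 3) pc).real
          {ω | θ / (12 * (K : ℝ)) * (2 * (m : ℝ) + 1) ^ 3 ≤ ((inBox ω ↑(box 3 (2 * m)) 0).ncard : ℝ)} :=
    h1 K hK1 m hm1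
  set k : ℕ := ⌈θ / (12 * (K : ℝ)) * (2 * (m : ℝ) + 1) ^ 3⌉₊ with hk_def
  have i2 : (bondPercolation (zdGraph 3) pc).real {ω | (k : ℝ) ≤ ((inBox ω ↑(box 3 (2 * m)) 0).ncard : ℝ)} *
        (1 - (pc : ℝ)) ^ (ε * (2 * ((2 * m : ℕ) : ℝ) + 1) ^ 2)
      ≤ (bondPercolation (zdGraph 3) pc).real
          {ω | openCluster ω 0 ⊆ ↑(box 3 (2 * (2 * m))) ∧ (k : ℝ) ≤ ((openCluster ω 0).ncard : ℝ)} :=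
    hM₀ (2 * m) hM₀2m k
  have i3 : (bondPercolation (zdGraph 3) pc).real
        {ω | openCluster ω (0 : Site 3) ⊆ ↑(box 3 (4 * m)) ∧
              δ * ((box 3 (4 * m)).card : ℝ) ≤ ((openCluster ω (0 : Site 3)).ncard : ℝ)}
      ≤ Real.exp (-(A * δ * ((4 * m : ℕ) : ℝ) ^ 2)) :=
    hm₀' (4 * m) hm₀'4m
  -- event inclusions
  have incl1 : {ω : BondConfig (Site 3) | θ / (12 * (K : ℝ)) * (2 * (m : ℝ) + 1) ^ 3 ≤
        ((inBox ω ↑(box 3 (2 * m)) 0).ncard : ℝ)}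
      ⊆ {ω | (k : ℝ) ≤ ((inBox ω ↑(box 3 (2 * m)) 0).ncard : ℝ)} := by
    intro ω hω
    simp only [Set.mem_setOf_eq] at hω ⊢
    have hk : k ≤ (inBox ω ↑(box 3 (2 * m)) 0).ncard := Nat.ceil_le.mpr hω
    exact_mod_cast hk
  have hbox : 2 * (2 * m) = 4 * m := by ring
  have incl2 : {ω : BondConfig (Site 3) | openCluster ω 0 ⊆ ↑(box 3 (2 * (2 * m))) ∧
        (k : ℝ) ≤ ((openCluster ω 0).ncard : ℝ)}
      ⊆ {ω | openCluster ω (0 : Site 3) ⊆ ↑(box 3 (4 * m)) ∧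
              δ * ((box 3 (4 * m)).card : ℝ) ≤ ((openCluster ω (0 : Site 3)).ncard : ℝ)} := by
    intro ω hω
    simp only [Set.mem_setOf_eq] at hω ⊢
    refine ⟨hbox ▸ hω.1, le_trans ?_ hω.2⟩
    have hcard : ((box 3 (4 * m)).card : ℝ) = (8 * (m : ℝ) + 1) ^ 3 := by
      rw [card_box]; push_cast; ring
    rw [hcard]
    calc δ * (8 * (m : ℝ) + 1) ^ 3 ≤ δ * (8 * (m : ℝ) + 4) ^ 3 := by gcongr; norm_num
      _ = θ / (12 * (K : ℝ)) * (2 * (m : ℝ) + 1) ^ 3 := by rw [hδ_def]; field_simp; ring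
      _ ≤ (k : ℝ) := Nat.le_ceil _
  -- the chain of inequalities
  have hy_nonneg : 0 ≤ (1 - (pc : ℝ)) ^ (ε * (2 * ((2 * m : ℕ) : ℝ) + 1) ^ 2) :=
    Real.rpow_nonneg h1pc0.le _
  have chain : θ ^ 2 / (144 * (K : ℝ) ^ 2) *
        (pc : ℝ) ^ (2 * (2 * (m : ℝ) + 1) ^ 2 / (K : ℝ) + 2 * (2 * (m : ℝ) + 1)) *
        (1 - (pc : ℝ)) ^ (ε * (2 * ((2 * m : ℕ) : ℝ) + 1) ^ 2)
      ≤ Real.exp (-(A * δ * ((4 * m : ℕ) : ℝ) ^ 2)) :=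
    calc θ ^ 2 / (144 * (K : ℝ) ^ 2) *
          (pc : ℝ) ^ (2 * (2 * (m : ℝ) + 1) ^ 2 / (K : ℝ) + 2 * (2 * (m : ℝ) + 1)) *
          (1 - (pc : ℝ)) ^ (ε * (2 * ((2 * m : ℕ) : ℝ) + 1) ^ 2)
        ≤ (bondPercolation (zdGraph 3) pc).real
            {ω | θ / (12 * (K : ℝ)) * (2 * (m : ℝ) + 1) ^ 3 ≤ ((inBox ω ↑(box 3 (2 * m)) 0).ncard : ℝ)} *
          (1 - (pc : ℝ)) ^ (ε * (2 * ((2 * m : ℕ) : ℝ) + 1) ^ 2) :=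
          mul_le_mul_of_nonneg_right i1 hy_nonneg
      _ ≤ (bondPercolation (zdGraph 3) pc).real {ω | (k : ℝ) ≤ ((inBox ω ↑(box 3 (2 * m)) 0).ncard : ℝ)} *
          (1 - (pc : ℝ)) ^ (ε * (2 * ((2 * m : ℕ) : ℝ) + 1) ^ 2) :=
          mul_le_mul_of_nonneg_right (MeasureTheory.measureReal_mono incl1) hy_nonneg
      _ ≤ (bondPercolation (zdGraph 3) pc).real
            {ω | openCluster ω 0 ⊆ ↑(box 3 (2 * (2 * m))) ∧ (k : ℝ) ≤ ((openCluster ω 0).ncard : ℝ)} := i2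
      _ ≤ (bondPercolation (zdGraph 3) pc).real
            {ω | openCluster ω (0 : Site 3) ⊆ ↑(box 3 (4 * m)) ∧
                  δ * ((box 3 (4 * m)).card : ℝ) ≤ ((openCluster ω (0 : Site 3)).ncard : ℝ)} :=
          MeasureTheory.measureReal_mono incl2
      _ ≤ Real.exp (-(A * δ * ((4 * m : ℕ) : ℝ) ^ 2)) := i3
  -- everything as one exponential, then compare exponents
  have hpref : θ ^ 2 / (144 * (K : ℝ) ^ 2) = Real.exp c₀ := by
    rw [hc₀_def, Real.exp_log (by positivity)]
  rw [hpref, Real.rpow_def_of_pos hpc0, Real.rpow_def_of_pos h1pc0, ← Real.exp_add, ← Real.exp_add,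
    Real.exp_le_exp] at chain
  have hlogpc : Real.log (pc : ℝ) = -ℓ := by rw [hℓ_def, neg_neg]
  have hlog1pc : Real.log (1 - (pc : ℝ)) = -Lc := by rw [hLc_def, neg_neg]
  rw [hlogpc, hlog1pc] at chain
  push_cast at chain
  have hεLc : Lc * (ε * (2 * (2 * (m : ℝ)) + 1) ^ 2) = δ / 4 * (4 * (m : ℝ) + 1) ^ 2 := by
    rw [hε_def]; field_simp; ring
  have hℓK : ℓ * (2 * (2 * (m : ℝ) + 1) ^ 2 / (K : ℝ) + 2 * (2 * (m : ℝ) + 1)) =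
      2 * u * (2 * (m : ℝ) + 1) ^ 2 + 2 * ℓ * (2 * (m : ℝ) + 1) := by
    rw [hu_def]; ring
  have hAx : A * δ * (4 * (m : ℝ)) ^ 2 = 8 * u * (m : ℝ) ^ 2 + 16 * δ * (m : ℝ) ^ 2 := by
    rw [show A * δ * (4 * (m : ℝ)) ^ 2 = (A * δ) * (16 * (m : ℝ) ^ 2) by ring, hAδ]; ring
  -- the droplet inequality says `12 δ m² ≤ bb·m + cc` …
  have hkey : 12 * δ * (m : ℝ) ^ 2 ≤ bb * (m : ℝ) + cc := by
    rw [hbb_def, hcc_def]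
    linarith only [chain, hεLc, hℓK, hAx]
  -- … which fails at the chosen large `m`
  have hax : bb + |cc| + 1 ≤ (m : ℝ) * (12 * δ) := (div_le_iff₀ (by positivity)).mp hbig
  have hm0 : (0 : ℝ) ≤ (m : ℝ) := by positivity
  have hfin : (bb + |cc| + 1) * (m : ℝ) ≤ (m : ℝ) * (12 * δ) * (m : ℝ) :=
    mul_le_mul_of_nonneg_right hax hm0
  have habs1 : |cc| ≤ |cc| * (m : ℝ) := le_mul_of_one_le_right (abs_nonneg _) h1m
  have habs2 : cc ≤ |cc| := le_abs_self cc
  linarith only [hkey, hfin, habs1, habs2, h1m]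

end Summit.CriticalPhenomena.PercolationContinuityZ3.Cruxes.DropletSurfaceCost.Disproof
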